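/-
Copyright (c) 2026 The decomp-a2c cell. All rights reserved.
Released under Apache 2.0 license as described in the file LICENSE.
-/
import Summits.AtomisticToContinuum.Crystallization.Theorems.ChartedZeroExcessLayeredLatticeLiouvilleWT

/-!
# ChartedZeroExcessLayeredLatticeLiouville — part WU «ComparisonData»: the data identity of the comparison profile and its `ϱ`-free chain-flux bound
  (decomp-a2c-lens-2, g58; helper of stmt-AtomisticToContinuum-26636, leaf (PC) `ProfileComparisonAt`; step §3(i) of memo NODE-g58d — the DATA fed to the
  window bootstrap of part WT)

For a field `φ`, an in-plane slope `g` and a layer profile `cf` whose mode `modeField g cf` has column flux `F` through every gap (part VV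
`mode_extraction` produces such a `cf` for any prescribed `g`, `F`), the comparison profile of the column `γ` is `φ γ − cf`; its increments are the (PC)
quantities `D₃φ(γ, β) − (cf(β+1) − cf β)` (`profile_increment_eq`), and its chain flux splits EXACTLY (`chainFlux_profile_sub_eq`):

  `chainFlux T (φ γ − cf) m = [colFlux T φ γ m − F] − [colPlanar T φ γ m − boxSlope g m]`

(WC `colFlux_eq_chainFlux_add` for `φ` and for the mode, WO `colFlux_modeField` / `colPlanar_modeField` / `chainFlux_modeField_col`, linearity
`chainFlux_col_sub`).  With `γ = x₀.1`, `g = slopeAt φ x₀` and `F = F* = colFlux T φ x₀.1 x₀.2` the two brackets are the flux drift of part WR and the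
slope mismatch of part WQ, whence the `ϱ`-FREE data bound (`norm_chainFlux_profile_le`, `…_natAbs` in the form consumed by WT `bootstrap_increment_le`):

  `‖chainFlux T (φ x₀.1 − cf) m‖ ≤ driftConst·(|m − x₀.2| + 1)·√(E(φ; idxBall x₀ n)/(n²·#idxBall x₀ n))`   for `|m − x₀.2| + 3⌊ϱ/c⌋₊ ≤ n/2`,

`driftConst = 216·K·(√(864·gradConst) + 2√(864·6912·(54K/κ₀)·lipConst) + √(864·ipConst))`.  The lemma is stated at an arbitrary centre `x₀` and
scale `n`, so it serves the re-anchored instances of the bootstrap as well (see the plan note in `ComparisonDataShape`).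
-/

namespace Summit.AtomisticToContinuum.Crystallization.Theorems.ChartedZeroExcessLayeredLatticeLiouville

open Summit.AtomisticToContinuum.Crystallization.Theorems.ChartedPlanarOrderRigidityDoor (E3)
open Finset
open scoped InnerProductSpace RealInnerProductSpace BigOperators

noncomputable section ComparisonData

variable {c : ℝ} {a b : E3} {w : ℤ → E3}

/-! ### WU.1  The comparison profile and the data identity -/

/-- the chain flux is subtractive in the profile. [formal bookkeeping] -/
theorem chainFlux_col_sub (hc : 0 < c) (hL : IsLayeredCrystal c a b w) (ϱ : ℝ) (T : Finset ℤ) (d₁ d₂ : ℤ → E3) (m : ℤ) :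
    chainFlux ϱ a b w T (d₁ - d₂) m = chainFlux ϱ a b w T d₁ m - chainFlux ϱ a b w T d₂ m := by
  unfold chainFlux
  rw [← sum_sub_distrib]
  refine sum_congr rfl fun α _ => ?_
  rw [← sum_sub_distrib]
  refine sum_congr rfl fun β _ => ?_
  rw [Pi.sub_apply, Pi.sub_apply, sub_sub_sub_comm, chainK_sub hc hL]

/-- the increments of the comparison profile `φ γ − cf` are the (PC) quantities `D₃φ(γ, β) − (cf(β+1) − cf β)`. [formal bookkeeping] -/
theorem profile_increment_eq (φ : Cell 2 → ℤ → E3) (γ : Cell 2) (cf : ℤ → E3) (β : ℤ) :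
    (φ γ - cf) (β + 1) - (φ γ - cf) β = latDiff idxAxis₃ φ γ β - (cf (β + 1) - cf β) := by
  rw [latDiff_axis₃_apply, Pi.sub_apply, Pi.sub_apply]
  abel

/-- ★ THE DATA IDENTITY: if the mode `modeField g cf` has column flux `F` through every gap, then over any kernel carrier containing the band box of
gap `m`, `chainFlux T (φ γ − cf) m = [colFlux T φ γ m − F] − [colPlanar T φ γ m − boxSlope g m]`. [this file, g58] -/
theorem chainFlux_profile_sub_eq (hc : 0 < c) (hL : IsLayeredCrystal c a b w) {ϱ : ℝ} (φ : Cell 2 → ℤ → E3) (g : Fin 2 → E3) (cf : ℤ → E3) {F : E3}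
    (hF : ∀ m' : ℤ, columnFlux ϱ a b w ⌊ϱ / c⌋₊ g cf m' = F) {T : Finset ℤ} {m : ℤ} (hT : Icc (m - ⌊ϱ / c⌋₊) (m + 1 + ⌊ϱ / c⌋₊) ⊆ T) (γ : Cell 2) :
    chainFlux ϱ a b w T (φ γ - cf) m =
      (colFlux ϱ a b w T φ γ m - F) - (colPlanar ϱ a b w T φ γ m - boxSlope ϱ a b w ⌊ϱ / c⌋₊ g m) := by
  have h1 : chainFlux ϱ a b w T (φ γ) m = colFlux ϱ a b w T φ γ m - colPlanar ϱ a b w T φ γ m :=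
    eq_sub_of_add_eq (colFlux_eq_chainFlux_add hc hL ϱ T φ γ m).symm
  have h2 : chainFlux ϱ a b w T cf m = F - boxSlope ϱ a b w ⌊ϱ / c⌋₊ g m := by
    rw [← chainFlux_modeField_col ϱ a b w T g cf γ m, ← hF m, ← colFlux_modeField hc hL g cf hT γ, ← colPlanar_modeField hc hL g cf hT γ]
    exact eq_sub_of_add_eq (colFlux_eq_chainFlux_add hc hL ϱ T (modeField g cf) γ m).symm
  rw [chainFlux_col_sub hc hL ϱ T (φ γ) cf m, h1, h2]
  abel

/-! ### WU.2  The drift constant and the `ϱ`-free data bound -/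

/-- the DRIFT CONSTANT `216·K·(√(864·gradConst) + 2·√(864·6912·(54K/κ₀)·lipConst) + √(864·ipConst))` — the `ϱ`-free coefficient of
`(|m − α₀| + 1)·ε₁` in the chain-flux data bound (parts WQ, WR). [this file, g58] -/
def driftConst (c κ₀ ε : ℝ) : ℝ :=
  216 * kernelConst c * (Real.sqrt (864 * gradConst c κ₀ ε) + 2 * Real.sqrt (864 * (6912 * (54 * kernelConst c / κ₀) * lipConst c κ₀)) +
    Real.sqrt (864 * ipConst c κ₀ ε))

/-- `driftConst ≥ 0`. [formal bookkeeping] -/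
theorem driftConst_nonneg (hc : 0 < c) (κ₀ ε : ℝ) : 0 ≤ driftConst c κ₀ ε := by
  have hF := kernelConst_nonneg hc
  unfold driftConst
  positivity

/-- square roots factor off the energy scale: `√(a·E/D) = √a·√(E/D)` for `a ≥ 0`. [formal bookkeeping] -/
theorem sqrt_scale_mul {s E D : ℝ} (hs : 0 ≤ s) : Real.sqrt (s * E / D) = Real.sqrt s * Real.sqrt (E / D) := by
  rw [mul_div_assoc, Real.sqrt_mul hs]

/-- ★★ THE `ϱ`-FREE DATA BOUND: for `φ` harmonic on `idxBall x₀ n` (`n ≥ 512(ϱ/c + 2)`), a profile `cf` whose mode with slope `slopeAt φ x₀` has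
column flux `F* = colFlux T φ x₀.1 x₀.2`, and a gap `m` with `|m − x₀.2| + 3⌊ϱ/c⌋₊ ≤ n/2` (carrier `T` containing its band box and the layers within
`|m − x₀.2| + ⌊ϱ/c⌋₊`):
`‖chainFlux T (φ x₀.1 − cf) m‖ ≤ driftConst·(|m − x₀.2| + 1)·√(E/(n²·#ball))` (WR flux drift + WQ slope mismatch via the data identity). [this file, g58] -/
theorem norm_chainFlux_profile_le (hc : 0 < c) (hL : IsLayeredCrystal c a b w) {κ₀ ε ϱ : ℝ} (hκ₀ : 0 < κ₀) (hϱ : 0 ≤ ϱ) (hε : ε < 2 * κ₀)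
    (hK : CoerciveZ (layeredKernel a b w) κ₀)
    (hT : ∀ φ : Cell 2 → ℤ → E3, HasFiniteSupport φ → Summable (tailFam ϱ a b w φ) ∧ ∑' x, tailFam ϱ a b w φ x ≤ ε * nnFormZ φ)
    (hP : ∀ E₀ : Cell 2 × ℤ, E₀.2 = 0 → (idxNorm E₀ : ℝ) ≤ 1 → ∀ (y₀ : Cell 2 × ℤ) (r' n' : ℝ), r' < n' → ∀ χ : Cell 2 → ℤ → E3,
      IsTruncHarmonicZ ϱ a b w χ (idxBall y₀ (n' + 1)) →
        κ₀ * idxEnergy (latDiff E₀ χ) (idxBall y₀ r') ≤ 54 * kernelConst c * ((n' - r')⁻¹) ^ 2 * idxEnergy χ (idxBall y₀ (n' + ϱ / c + 1)))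
    (x₀ : Cell 2 × ℤ) {n : ℝ} (hn : 512 * (ϱ / c + 2) ≤ n) {φ : Cell 2 → ℤ → E3} (hφ : IsTruncHarmonicZ ϱ a b w φ (idxBall x₀ n))
    {cf : ℤ → E3} {T : Finset ℤ} (hF : ∀ m' : ℤ, columnFlux ϱ a b w ⌊ϱ / c⌋₊ (slopeAt φ x₀) cf m' = colFlux ϱ a b w T φ x₀.1 x₀.2)
    {m : ℤ} (hm : |((m - x₀.2 : ℤ) : ℝ)| + 3 * (⌊ϱ / c⌋₊ : ℝ) ≤ n / 2) (hTm₁ : Icc (m - ⌊ϱ / c⌋₊) (m + 1 + ⌊ϱ / c⌋₊) ⊆ T)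
    (hTm₂ : ∀ β : ℤ, |((β - x₀.2 : ℤ) : ℝ)| ≤ |((m - x₀.2 : ℤ) : ℝ)| + ⌊ϱ / c⌋₊ → β ∈ T) :
    ‖chainFlux ϱ a b w T (φ x₀.1 - cf) m‖ ≤
      driftConst c κ₀ ε * (|((m - x₀.2 : ℤ) : ℝ)| + 1) * Real.sqrt (idxEnergy φ (idxBall x₀ n) / (n ^ 2 * ((idxBall x₀ n).ncard : ℝ))) := by
  have hK0 := kernelConst_nonneg hc
  have hgc := gradConst_nonneg hc hκ₀ ε
  have hip := ipConst_nonneg hc hκ₀ ε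
  have hlip : 0 ≤ lipConst c κ₀ := by linarith [one_le_lipConst hc hκ₀]
  have hr0 : (0 : ℝ) ≤ (⌊ϱ / c⌋₊ : ℝ) := Nat.cast_nonneg _
  have ht0 : 0 ≤ |((m - x₀.2 : ℤ) : ℝ)| := abs_nonneg _
  have he0 : 0 ≤ Real.sqrt (idxEnergy φ (idxBall x₀ n) / (n ^ 2 * ((idxBall x₀ n).ncard : ℝ))) := Real.sqrt_nonneg _
  have h2 : 0 ≤ 864 * (6912 * (54 * kernelConst c / κ₀) * lipConst c κ₀) := by positivity
  rw [chainFlux_profile_sub_eq hc hL φ (slopeAt φ x₀) cf hF hTm₁ x₀.1]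
  have hA := norm_colFlux_drift_le hc hL hκ₀ hϱ hε hK hT hP x₀ hn hφ hm hTm₂
  have hB := norm_colPlanar_sub_boxSlope_le hc hL hκ₀ hϱ hε hK hT hP x₀ hn hφ hTm₁ (by linarith)
  rw [sqrt_scale_mul (by positivity : (0 : ℝ) ≤ 864 * gradConst c κ₀ ε), sqrt_scale_mul h2] at hA
  rw [sqrt_scale_mul (by positivity : (0 : ℝ) ≤ 864 * ipConst c κ₀ ε)] at hB
  have h1 : 216 * kernelConst c * (Real.sqrt (864 * gradConst c κ₀ ε) * Real.sqrt (idxEnergy φ (idxBall x₀ n) / (n ^ 2 * ((idxBall x₀ n).ncard : ℝ))) +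
      2 * (Real.sqrt (864 * (6912 * (54 * kernelConst c / κ₀) * lipConst c κ₀)) *
        Real.sqrt (idxEnergy φ (idxBall x₀ n) / (n ^ 2 * ((idxBall x₀ n).ncard : ℝ))))) * |((m - x₀.2 : ℤ) : ℝ)| ≤
      216 * kernelConst c * (Real.sqrt (864 * gradConst c κ₀ ε) * Real.sqrt (idxEnergy φ (idxBall x₀ n) / (n ^ 2 * ((idxBall x₀ n).ncard : ℝ))) +
      2 * (Real.sqrt (864 * (6912 * (54 * kernelConst c / κ₀) * lipConst c κ₀)) *
        Real.sqrt (idxEnergy φ (idxBall x₀ n) / (n ^ 2 * ((idxBall x₀ n).ncard : ℝ))))) * (|((m - x₀.2 : ℤ) : ℝ)| + 1) :=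
    mul_le_mul_of_nonneg_left (by linarith) (by positivity)
  calc ‖colFlux ϱ a b w T φ x₀.1 m - colFlux ϱ a b w T φ x₀.1 x₀.2 -
        (colPlanar ϱ a b w T φ x₀.1 m - boxSlope ϱ a b w ⌊ϱ / c⌋₊ (slopeAt φ x₀) m)‖
      ≤ ‖colFlux ϱ a b w T φ x₀.1 m - colFlux ϱ a b w T φ x₀.1 x₀.2‖ +
        ‖colPlanar ϱ a b w T φ x₀.1 m - boxSlope ϱ a b w ⌊ϱ / c⌋₊ (slopeAt φ x₀) m‖ := norm_sub_le _ _
    _ ≤ _ := add_le_add hA hB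
    _ ≤ driftConst c κ₀ ε * (|((m - x₀.2 : ℤ) : ℝ)| + 1) * Real.sqrt (idxEnergy φ (idxBall x₀ n) / (n ^ 2 * ((idxBall x₀ n).ncard : ℝ))) := by
        unfold driftConst
        linarith

/-- ★★ the same bound in the `natAbs` form consumed by part WT (`hCF` of `bootstrap_increment_le` with `Ch = driftConst`, `ε₁ = √(E/(n²·#ball))`).
[this file, g58] -/
theorem norm_chainFlux_profile_le_natAbs (hc : 0 < c) (hL : IsLayeredCrystal c a b w) {κ₀ ε ϱ : ℝ} (hκ₀ : 0 < κ₀) (hϱ : 0 ≤ ϱ) (hε : ε < 2 * κ₀)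
    (hK : CoerciveZ (layeredKernel a b w) κ₀)
    (hT : ∀ φ : Cell 2 → ℤ → E3, HasFiniteSupport φ → Summable (tailFam ϱ a b w φ) ∧ ∑' x, tailFam ϱ a b w φ x ≤ ε * nnFormZ φ)
    (hP : ∀ E₀ : Cell 2 × ℤ, E₀.2 = 0 → (idxNorm E₀ : ℝ) ≤ 1 → ∀ (y₀ : Cell 2 × ℤ) (r' n' : ℝ), r' < n' → ∀ χ : Cell 2 → ℤ → E3,
      IsTruncHarmonicZ ϱ a b w χ (idxBall y₀ (n' + 1)) →
        κ₀ * idxEnergy (latDiff E₀ χ) (idxBall y₀ r') ≤ 54 * kernelConst c * ((n' - r')⁻¹) ^ 2 * idxEnergy χ (idxBall y₀ (n' + ϱ / c + 1)))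
    (x₀ : Cell 2 × ℤ) {n : ℝ} (hn : 512 * (ϱ / c + 2) ≤ n) {φ : Cell 2 → ℤ → E3} (hφ : IsTruncHarmonicZ ϱ a b w φ (idxBall x₀ n))
    {cf : ℤ → E3} {T : Finset ℤ} (hF : ∀ m' : ℤ, columnFlux ϱ a b w ⌊ϱ / c⌋₊ (slopeAt φ x₀) cf m' = colFlux ϱ a b w T φ x₀.1 x₀.2)
    {m : ℤ} (hm : |((m - x₀.2 : ℤ) : ℝ)| + 3 * (⌊ϱ / c⌋₊ : ℝ) ≤ n / 2) (hTm₁ : Icc (m - ⌊ϱ / c⌋₊) (m + 1 + ⌊ϱ / c⌋₊) ⊆ T)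
    (hTm₂ : ∀ β : ℤ, |((β - x₀.2 : ℤ) : ℝ)| ≤ |((m - x₀.2 : ℤ) : ℝ)| + ⌊ϱ / c⌋₊ → β ∈ T) :
    ‖chainFlux ϱ a b w T (φ x₀.1 - cf) m‖ ≤
      driftConst c κ₀ ε * (((((m - x₀.2).natAbs : ℕ)) : ℝ) + 1) * Real.sqrt (idxEnergy φ (idxBall x₀ n) / (n ^ 2 * ((idxBall x₀ n).ncard : ℝ))) := by
  have e1 : ((((m - x₀.2).natAbs : ℕ)) : ℝ) = |((m - x₀.2 : ℤ) : ℝ)| := by rw [Nat.cast_natAbs, Int.cast_abs]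
  rw [e1]
  exact norm_chainFlux_profile_le hc hL hκ₀ hϱ hε hK hT hP x₀ hn hφ hF hm hTm₁ hTm₂

/-! ### WU.3  The closed statement of this part -/

/-- The content of part WU as one closed proposition: the data identity of the comparison profile and its `ϱ`-free chain-flux bound in WT«s form.
PLAN NOTE for the successor (recorded with the critic): the window bootstrap anchored at `x₀` reaches `|β − x₀.2| ≲ n/5` only (its windows must fit
inside the data range `n/2`); the range `n/2` demanded by (PC) is obtained by RE-ANCHORING at `x₁ = (x₀.1, x₀.2 ± ⌊n/3⌋)` (ball `idxBall x₁ (2n/3) ⊆ idxBall x₀ n`)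
with the corrected profile `cf + cf_Δ`, `cf_Δ = mode_extraction (slopeAt φ x₁ − slopeAt φ x₀) (colFlux(x₁) − colFlux(x₀))`, whose increments are
`≤ modeConst·(‖ΔF‖ + 441K‖Δg‖) = O(|x₁.2 − x₀.2|·ε₁)` by parts WR and WM — this lemma, WT and VV are all stated at an arbitrary centre. -/
def ComparisonDataShape : Prop :=
  (∀ (φ : Cell 2 → ℤ → E3) (γ : Cell 2) (cf : ℤ → E3) (β : ℤ),
      (φ γ - cf) (β + 1) - (φ γ - cf) β = latDiff idxAxis₃ φ γ β - (cf (β + 1) - cf β)) ∧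
  (∀ c κ₀ ε : ℝ, 0 < c → 0 ≤ driftConst c κ₀ ε) ∧
  ∀ c : ℝ, ∀ hc : 0 < c, ∀ (a b : E3) (w : ℤ → E3), ∀ hL : IsLayeredCrystal c a b w,
    (∀ (ϱ : ℝ) (φ : Cell 2 → ℤ → E3) (g : Fin 2 → E3) (cf : ℤ → E3) (F : E3), (∀ m' : ℤ, columnFlux ϱ a b w ⌊ϱ / c⌋₊ g cf m' = F) →
      ∀ (T : Finset ℤ) (m : ℤ), Icc (m - ⌊ϱ / c⌋₊) (m + 1 + ⌊ϱ / c⌋₊) ⊆ T → ∀ γ : Cell 2,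
        chainFlux ϱ a b w T (φ γ - cf) m = (colFlux ϱ a b w T φ γ m - F) - (colPlanar ϱ a b w T φ γ m - boxSlope ϱ a b w ⌊ϱ / c⌋₊ g m)) ∧
    ∀ κ₀ ε ϱ : ℝ, 0 < κ₀ → 0 ≤ ϱ → ε < 2 * κ₀ → CoerciveZ (layeredKernel a b w) κ₀ →
      (∀ φ : Cell 2 → ℤ → E3, HasFiniteSupport φ → Summable (tailFam ϱ a b w φ) ∧ ∑' x, tailFam ϱ a b w φ x ≤ ε * nnFormZ φ) →
      (∀ E₀ : Cell 2 × ℤ, E₀.2 = 0 → (idxNorm E₀ : ℝ) ≤ 1 → ∀ (y₀ : Cell 2 × ℤ) (r' n' : ℝ), r' < n' → ∀ χ : Cell 2 → ℤ → E3,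
        IsTruncHarmonicZ ϱ a b w χ (idxBall y₀ (n' + 1)) →
          κ₀ * idxEnergy (latDiff E₀ χ) (idxBall y₀ r') ≤ 54 * kernelConst c * ((n' - r')⁻¹) ^ 2 * idxEnergy χ (idxBall y₀ (n' + ϱ / c + 1))) →
      ∀ (x₀ : Cell 2 × ℤ) (n : ℝ), 512 * (ϱ / c + 2) ≤ n → ∀ φ : Cell 2 → ℤ → E3, IsTruncHarmonicZ ϱ a b w φ (idxBall x₀ n) →
        ∀ (cf : ℤ → E3) (T : Finset ℤ), (∀ m' : ℤ, columnFlux ϱ a b w ⌊ϱ / c⌋₊ (slopeAt φ x₀) cf m' = colFlux ϱ a b w T φ x₀.1 x₀.2) →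
          ∀ m : ℤ, |((m - x₀.2 : ℤ) : ℝ)| + 3 * (⌊ϱ / c⌋₊ : ℝ) ≤ n / 2 → Icc (m - ⌊ϱ / c⌋₊) (m + 1 + ⌊ϱ / c⌋₊) ⊆ T →
            (∀ β : ℤ, |((β - x₀.2 : ℤ) : ℝ)| ≤ |((m - x₀.2 : ℤ) : ℝ)| + ⌊ϱ / c⌋₊ → β ∈ T) →
            ‖chainFlux ϱ a b w T (φ x₀.1 - cf) m‖ ≤
              driftConst c κ₀ ε * (((((m - x₀.2).natAbs : ℕ)) : ℝ) + 1) * Real.sqrt (idxEnergy φ (idxBall x₀ n) / (n ^ 2 * ((idxBall x₀ n).ncard : ℝ)))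

/-- WU holds. [this file, g58] -/
theorem comparisonDataShape_holds : ComparisonDataShape :=
  ⟨profile_increment_eq, fun _c κ₀ ε hc => driftConst_nonneg hc κ₀ ε, fun _c hc _a _b _w hL =>
    ⟨fun _ϱ φ g cf _F hF _T _m hT γ => chainFlux_profile_sub_eq hc hL φ g cf hF hT γ,
    fun _κ₀ _ε _ϱ hκ₀ hϱ hε hK hT hP x₀ _n hn _φ hφ _cf _T hF _m hm hTm₁ hTm₂ =>
      norm_chainFlux_profile_le_natAbs hc hL hκ₀ hϱ hε hK hT hP x₀ hn hφ hF hm hTm₁ hTm₂⟩⟩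

end ComparisonData

end Summit.AtomisticToContinuum.Crystallization.Theorems.ChartedZeroExcessLayeredLatticeLiouville
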